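/-
Copyright (c) 2026. All rights reserved.
Released under Apache 2.0 license as described in the file LICENSE.
Authors: HodgeCM publication cell (pub-hodgecm), GR lane, seat GR-2 (`pub-hodgecm-own-hyp34`).
-/
import Literature.NumberTheory.GelbartRogawski1991.UnitaryDualPairThetaKernelCM
import Literature.NumberTheory.GelbartRogawski1991.Prop311AsPrinted
import Literature.NumberTheory.Weil1964.AdelicMetaplecticRationalSectionUnique
import Literature.RepresentationTheory.HeisenbergGroup.SymplecticGroupPerfect
import HarnessLib

/-!
# The rational splitting `i` of the [GelbartRogawski1991, §3.1] splitting data of record is THE unique one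

Topic `NumberTheory/GelbartRogawski1991`; namespace `Literature.NumberTheory.GelbartRogawski1991`.  KERNEL only:
theorems; no definition, no named fact, no `axiom`, no proof hole.

[GelbartRogawski1991, §3.1 p. 454 L35–36] (verbatim): "*It is known ([We]) that `π` splits uniquely over the group of
`F`-rational points `Sp_F(W)`. We denote this splitting by `i`.*"  The splitting data of record for the unitary dual
pairs (`UnitaryDualPair.splittingDatum`, and its CM instance `UnitaryDualPair.cmSplittingDatum` whose
`CompatibleSplitting` is the theorem `GRConstruction.gru_shape`) carry as their field `ratSplit` Weil's Θ-fixing section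
`UnitaryDualPair.ratSection = r_F ∘ (Sp_F(𝕎) ≃ Sp_{2n}(F))` (`UnitaryDualPairSplittingDatum`); the object-match note (b)
of `CompatibleSplitting.lean` identified it with print's `i` through Θ-rigidity ([Weil1964] Thm 6: two Θ-fixing
sections coincide).  With `Weil1964.AdelicMetaplecticRationalSectionUnique` (the printed uniqueness for the
metaplectic group of record, from `ker π =` central scalars and the perfectness of `Sp_{2n}(F)`) this file records the
identification as a THEOREM, with no Θ-qualifier:

* §1 `UnitaryDualPair.ratSection_unique` — every homomorphic section `j : Sp_F(𝕎) →* Mp_ψ(𝕎_𝔸)ᶜᵒⁿᵗ` of `π` over the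
  subgroup `Sp_F(𝕎) = range ratSp ≤ Sp(𝕎_𝔸)` IS `ratSection`; `UnitaryDualPair.existsUnique_ratSection`.
* §2 `UnitaryDualPair.splittingDatum_ratSplit_unique` ∕ `UnitaryDualPair.cmSplittingDatum_ratSplit_unique` — for the
  data of record `D`, every section of `D.proj` over `D.spRat` IS `D.ratSplit`: the field `i` is forced, so
  `D.IsCompatible s` ("`s(G(F)) ⊆ i(Sp_F(W))`") does not depend on any choice made in constructing `i`
  (`UnitaryDualPair.splittingDatum_isCompatible_iff_of_section`).
* §3 the printed `Sp_F(W)` of the statement-exact typing `Prop311AsPrinted` (`Prop311.ratSp F E V Φ`, the isometry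
  group of the trace form `Tr_{E/F} Φ` of a skew-Hermitian space, an ABSTRACT symplectic `F`-space): it has no
  non-trivial homomorphism to a commutative group (`Prop311.monoidHom_ratSp_eq_one`, from
  `HeisenbergGroup.SymplecticGroupPerfect`), so two homomorphic sections of ANY central-kernel `π` over it coincide
  (`Prop311.eq_of_proj_comp_eq_of_ker_le_center`) — the group-theoretic half of the binder `_hi!` ("`i` is THE unique
  splitting") of `Prop311AsPrinted`; the other half, `ker π ≤ center` for the printed Hilbert-space `Mp_𝐀(W)`, is
  Schur's lemma for the irreducible unitary `ρ_ψ` and is NOT proved here.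

Nothing of [GelbartRogawski1991] / [Weil1964] is asserted; `Prop311AsPrinted` is untouched (no hypothesis of it is
assumed or discharged here); HC_CM is not touched.

## References
* [GelbartRogawski1991] S. Gelbart, J. Rogawski, Invent. Math. 105 (1991), §3.1 p. 454 L35–42, Prop. 3.1.1 p. 455 L1–3.
* [Weil1964] A. Weil, Acta Math. 111 (1964), Chap. III n° 40 p. 190, n° 41 Thm 6 p. 193.
* [MoeglinVignerasWaldspurger1987] C. Mœglin, M.-F. Vignéras, J.-L. Waldspurger, LNM 1291 (1987), Chap. 2 II.1 (B).
-/

set_option autoImplicit false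

noncomputable section

open scoped Matrix
open NumberField

namespace Literature.NumberTheory.GelbartRogawski1991

open Literature.NumberTheory.Weil1964 Literature.NumberTheory.Automorphic
open Literature.RepresentationTheory.HeisenbergGroup

/-! ## §1 `ratSection` is the unique section of `π` over `Sp_F(𝕎)` -/

namespace UnitaryDualPair

section RatSection

variable (F : Type) [Field F] [NumberField F] {n : ℕ} (T : Matrix (Fin n) (Fin n) (AdeleRing (𝓞 F) F))
  (hT : IsUnit T.det)

/-- **`i = ratSection` is THE section of `π` over `Sp_F(𝕎)`**: every homomorphism
`j : Sp_F(𝕎) = range ratSp →* Mp_ψ(𝕎_𝔸)ᶜᵒⁿᵗ` with `π (j x) = x` equals `ratSection`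
(`Weil1964.ratPointsThetaLiftCont_unique`). [cite: GelbartRogawski1991, §3.1 p. 454 L35–36] -/
theorem ratSection_unique (j : (ratSp F T hT).range →* adelicMpCont F (Fin n) T)
    (hj : ∀ x, adelicMpCont.proj F (Fin n) T (j x) = (x : symplecticGroup (polar (adelicForm F (Fin n) T)))) :
    j = ratSection F T hT :=
  eq_of_proj_eq_coe_ratPoints F (Fin n) T hT j (ratSection F T hT) hj (proj_ratSection F T hT)

/-- **"`π` splits uniquely over `Sp_F(𝕎)`; we denote this splitting by `i`"**: there is exactly one homomorphic
section of `π : Mp_ψ(𝕎_𝔸)ᶜᵒⁿᵗ → Sp(𝕎_𝔸)` over the subgroup `Sp_F(𝕎)`, namely `ratSection`.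
[cite: GelbartRogawski1991, §3.1 p. 454 L35–36; Weil1964, Chap. III n° 40 p. 190] -/
theorem existsUnique_ratSection :
    ∃! j : (ratSp F T hT).range →* adelicMpCont F (Fin n) T,
      ∀ x, adelicMpCont.proj F (Fin n) T (j x) = (x : symplecticGroup (polar (adelicForm F (Fin n) T))) :=
  ⟨ratSection F T hT, proj_ratSection F T hT, fun j hj => ratSection_unique F T hT j hj⟩

end RatSection

/-! ## §2 The field `ratSplit` of the splitting data of record is forced -/

section Datum

variable (F E : Type) [Field F] [NumberField F] [Field E] [NumberField E] [Algebra F E]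
variable (c : E ≃ₐ[F] E) (N M : ℕ) {n : ℕ} (e : Fin N × Fin M ≃ Fin n)
variable (JV : Matrix (Fin N) (Fin N) E) (JW : Matrix (Fin M) (Fin M) E)
variable [Algebra.IsQuadraticExtension F E] {δ : E} (hcδ : c δ = -δ) (hδ : δ ≠ 0) {d : F}
  (hd : δ * δ = algebraMap F E d) {TV : Matrix (Fin N) (Fin N) F} {TW : Matrix (Fin M) (Fin M) F}
  (hV : TV.IsSymm) (hW : TW.IsSymm) (hVd : IsUnit TV.det) (hWd : IsUnit TW.det)
  (hJV : JV = TV.map (algebraMap F E)) (hJW : JW = TW.map (algebraMap F E))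

/-- **In the splitting datum of record of the dual pair `U(J_V) × U(J_W)`, the rational splitting `i` is forced**:
every homomorphic section of `D.proj` over `D.spRat = Sp_F(𝕎)` equals `D.ratSplit`.
[cite: GelbartRogawski1991, §3.1 p. 454 L35–36] -/
theorem splittingDatum_ratSplit_unique
    (j : (splittingDatum F E c N M e JV JW hcδ hδ hd hV hW hVd hWd hJV hJW).spRat →*
      adelicMpCont F (Fin n) (adelicGram F e TV TW))
    (hj : ∀ x, (splittingDatum F E c N M e JV JW hcδ hδ hd hV hW hVd hWd hJV hJW).proj (j x) =
      (x : symplecticGroup (polar (adelicForm F (Fin n) (adelicGram F e TV TW))))) :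
    j = (splittingDatum F E c N M e JV JW hcδ hδ hd hV hW hVd hWd hJV hJW).ratSplit :=
  ratSection_unique F (adelicGram F e TV TW) (isUnit_det_adelicGram F e hVd hWd) j hj

/-- consequently "`s(G(F)) ⊆ i(Sp_F(𝕎))`" means the same thing for ANY section `j` of `π` over `Sp_F(𝕎)`:
`IsCompatible` does not depend on the construction of `i`. [cite: GelbartRogawski1991, §3.1 Prop. 3.1.1 p. 455 L1–3] -/
theorem splittingDatum_isCompatible_iff_of_section
    (j : (splittingDatum F E c N M e JV JW hcδ hδ hd hV hW hVd hWd hJV hJW).spRat →*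
      adelicMpCont F (Fin n) (adelicGram F e TV TW))
    (hj : ∀ x, (splittingDatum F E c N M e JV JW hcδ hδ hd hV hW hVd hWd hJV hJW).proj (j x) =
      (x : symplecticGroup (polar (adelicForm F (Fin n) (adelicGram F e TV TW)))))
    (s : UnitaryGroup.adelicPair F E c N M JV JW →* adelicMpCont F (Fin n) (adelicGram F e TV TW)) :
    (splittingDatum F E c N M e JV JW hcδ hδ hd hV hW hVd hWd hJV hJW).IsCompatible s ↔
      (∀ g, (splittingDatum F E c N M e JV JW hcδ hδ hd hV hW hVd hWd hJV hJW).proj (s g) =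
          (splittingDatum F E c N M e JV JW hcδ hδ hd hV hW hVd hWd hJV hJW).toSp g) ∧
        ∀ γ ∈ (splittingDatum F E c N M e JV JW hcδ hδ hd hV hW hVd hWd hJV hJW).ratPts, s γ ∈ j.range := by
  have hj' := splittingDatum_ratSplit_unique F E c N M e JV JW hcδ hδ hd hV hW hVd hWd hJV hJW j hj
  subst hj'
  exact Iff.rfl

end Datum

section CM

variable (L : Type) [Field L] [NumberField L] [IsCMField L] {N M n : ℕ} (e : Fin N × Fin M ≃ Fin n)
variable (dV : Fin N → L) (hdV : ∀ i, IsCMField.complexConj L (dV i) = dV i) (hdV0 : ∀ i, dV i ≠ 0)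
variable (dW : Fin M → L) (hdW : ∀ i, IsCMField.complexConj L (dW i) = dW i) (hdW0 : ∀ i, dW i ≠ 0)

/-- **CM instance** (the datum of `GRConstruction.gru_shape`): in `cmSplittingDatum L e dV … dW …` the rational
splitting `i` is THE unique homomorphic section of `π` over `Sp_{L⁺}(𝕎)`.
[cite: GelbartRogawski1991, §3.1 p. 454 L35–36] -/
theorem cmSplittingDatum_ratSplit_unique
    (j : (cmSplittingDatum L e dV hdV hdV0 dW hdW hdW0).spRat →*
      adelicMpCont (↥(maximalRealSubfield L)) (Fin n)
        (adelicGram (↥(maximalRealSubfield L)) e (realDiagonal L dV hdV) (realDiagonal L dW hdW)))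
    (hj : ∀ x, (cmSplittingDatum L e dV hdV hdV0 dW hdW hdW0).proj (j x) =
      (x : symplecticGroup (polar (adelicForm (↥(maximalRealSubfield L)) (Fin n)
        (adelicGram (↥(maximalRealSubfield L)) e (realDiagonal L dV hdV) (realDiagonal L dW hdW)))))) :
    j = (cmSplittingDatum L e dV hdV hdV0 dW hdW hdW0).ratSplit :=
  splittingDatum_ratSplit_unique (↥(maximalRealSubfield L)) L (IsCMField.complexConj L) N M e (Matrix.diagonal dV)
    (Matrix.diagonal dW) (complexConj_imagUnit L) (imagUnit_ne_zero L) (imagUnit_mul_self L)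
    (realDiagonal_isSymm L dV hdV) (realDiagonal_isSymm L dW hdW) (isUnit_det_realDiagonal L dV hdV hdV0)
    (isUnit_det_realDiagonal L dW hdW hdW0) (realDiagonal_map L dV hdV).symm (realDiagonal_map L dW hdW).symm j hj

end CM

end UnitaryDualPair

/-! ## §3 The printed `Sp_F(W)` of `Prop311AsPrinted` has no characters -/

namespace Prop311

variable (F : Type) [Field F] [NumberField F]
variable (E : Type) [Field E] [Algebra F E]
variable (V : Type) [AddCommGroup V] [Module F V] [FiniteDimensional F V]
variable (Φ : V →ₗ[F] V →ₗ[F] E)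

/-- **`Sp_F(W)` of [GR91 §3.1] has no non-trivial homomorphism to a commutative group**: for the trace form
`φ = Tr_{E/F} Φ` alternating and non-degenerate ("`(W, φ)` … symplectic space", p. 454 L17, L40–42) and `W` finite
dimensional over `F`, every `χ : ratSp F E V Φ →* A` is trivial (`HeisenbergGroup.SymplecticGroupPerfect`, `F` of
characteristic `0`). [cite: GelbartRogawski1991, §3.1 p. 454 L35–42] -/
theorem monoidHom_ratSp_eq_one (hA : (traceForm F E V Φ).IsAlt) (hN : (traceForm F E V Φ).Nondegenerate)
    {A : Type*} [CommGroup A] (χ : ratSp F E V Φ →* A) : χ = 1 :=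
  Heisenberg.PseudoSymplectic.monoidHom_isometries_eq_one (traceForm F E V Φ) hA hN χ

/-- **Uniqueness of the printed `i` is group theory plus `ker π ≤ center`**: for ANY homomorphism `π : Mp →* Sp`
with central kernel and any `f : Sp_F(W) →* Sp`, two homomorphisms `i i′ : Sp_F(W) →* Mp` over `f` coincide.  (For
print's `Mp_𝐀(W)` over the Hilbert space of an irreducible unitary `ρ_ψ`, `ker π ≤ center` is Schur's lemma — not
proved here.) [cite: GelbartRogawski1991, §3.1 p. 454 L35–36; MoeglinVignerasWaldspurger1987, Chap. 2 II.1 (B)] -/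
theorem eq_of_proj_comp_eq_of_ker_le_center (hA : (traceForm F E V Φ).IsAlt)
    (hN : (traceForm F E V Φ).Nondegenerate) {Mp Sp : Type*} [Group Mp] [Group Sp] (π : Mp →* Sp)
    (hker : π.ker ≤ Subgroup.center Mp) (i i' : ratSp F E V Φ →* Mp) (h : ∀ g, π (i g) = π (i' g)) : i = i' :=
  Heisenberg.PseudoSymplectic.eq_of_comp_eq_of_ker_le_center (traceForm F E V Φ) hA hN π hker i i' h

end Prop311

end Literature.NumberTheory.GelbartRogawski1991

end
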